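import Mathlib
import HarnessLib
import HarnessLib.Audit
import Summits.AtomisticToContinuum.Statement
import Literature.MathematicalPhysics.KineticTheory.LangevinChainGibbs
import Literature.MathematicalPhysics.KineticTheory.LangevinChainDynkin
import Literature.MathematicalPhysics.KineticTheory.LangevinSemigroup
import Literature.MathematicalPhysics.KineticTheory.PhaseSpacePoisson
import Literature.Barriers.AtomisticToContinuum.MacroErgodicityHypothesis
import Literature.Barriers.AtomisticToContinuum.FixedLengthNoConductivityControl

/-!
Route: OpenChainMazur

CLOSED (retired) 2026-08-15T13:45:21Z by operator:999:1257524 — reason: not-a-thesis: assembly does not conclude the sub-problem Statement — note: D-0027 §2.1 audit (human 2026-08-15: routes that do not decide the summit are removed): the assembly concludes `¬ Literature.MathematicalPhysics.KineticTheory.HeatConduction.FouriersLaw`, not the sub-problem statement; a NEW conforming route may be opened from the same idea (generated `closes : … → . The file is kept as the record of this route; refuted decls are indexed as negative knowledge (`ledger negatives`).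

NEGATIVE-SIDE / NECESSARY-CONDITION INSTRUMENT (idea card open-chain-mazur-bridge). X_OCM := "at
some admissible parameter point (ω₂, lam, β > 0), temperature T > 0, the INFINITE pinned chain
carries a finite-range POLYNOMIAL conserved density g that is ODD under momentum reversal (local
conservation law liouvilleZ (g∘box) = ψ − ψ∘shift) and whose bulk charge Q_N = Σ_x g(sites x..x+2R)
has EXTENSIVE static overlap with the total current in the free-end N-chain Gibbs state, |∫ J_N·Q_N
dGibbs_{N,T}| ≥ cN". If X_OCM holds then, for every bath coupling γ > 0, the
Bonetto–Lebowitz–Rey-Bellet response coefficients satisfy D_N(T) ≥ c′N, so FouriersLawFor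
(pinnedChain ω₂ lam β γ) fails and FouriersLaw is FALSE. The bridge OddLocalCharge ⇒ ¬FouriersLawFor
is split at open into three theorem-grade, fixed-N statements over in-tree objects: StaticKubo (the
Kundu–Dhar–Narayan open-chain Green–Kubo identity in static Poisson-equation form: D_N·(N−1)T² = ∫
F·J dGibbs_{N,T} for F solving L_{T,T}F = −J), ThomsonBound (support; Cauchy–Schwarz: for any
DRESSED test function G, i.e. {H_N,G} = T Σ_{baths b} ∂*_{p_b} w_b, one has γ(∫ J G)² ≤ (∫ F J)·T
Σ_b ∫ (γ ∂_{p_b} G + w_b)²) and DressedCharge (the charge, dressed by boundary-layer correctors, is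
such a G with overlap ≥ cN and O(1) leak because charge and dissipation leak only through the two
thermostatted momenta). The existence clause OddChargeExists is NOT expected to hold (pinning is
believed to destroy all odd local conservation laws; DicintioEtAl2018, MazurBoundBallisticNarrow
(5)); the route is opened as the formal negative edge of the programme: its bridge items make any
discovered charge — or any certificate "no odd charge of range ≤ r, degree ≤ d" — bear FORMALLY on
the conjunct (today Mazur's obstruction only touches the closed-chain κ_GK, MazurBoundBallistic
scope caveat), and contrapositively turn "no momentum-odd local conservation law with current
overlap" into a certified necessary condition of Fourier's law in BLR's own formulation. Either
verdict on OddChargeExists is informative: refuted (expected; adversarial item =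
LocalOhmRigidity.NoLocalIntegrals, stmt-2744) ⇒ route closes refuted with
StaticKubo/ThomsonBound/DressedCharge/OpenMazurBridge surviving as proved instruments wanted by
FourierGreenKubo (ii), FeketeResistance/SuperadditiveJunction (PositiveConductance, NonBallistic);
proved ⇒ ¬FouriersLaw.
Lean: StaticKubo → ThomsonBound → DressedCharge → OddChargeExists → ¬
Literature.MathematicalPhysics.KineticTheory.HeatConduction.FouriersLaw
## Assembly
OddChargeExists supplies (ω₂, lam, β, γ, T) and the charge; BridgeGlue (support, ~120 Lean lines:
assume FouriersLawFor, take uniqueness and the steady-state family from its clause (i), D_N → κ from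
clause (ii), F from StaticKubo, G from DressedCharge, ThomsonBound ⇒ D_N ≥ γc²N²/((N−1)T²C(1+γ²))
unbounded, contradiction) gives OpenMazurBridge; FouriersLaw at (ω₂, lam, β, γ) contradicts it.
`theorem assembly_of_glue : BridgeGlue → Assembly` is proved in the planner's Sketch.lean (rc 0).

Rationale: WHY THIS LINE. The catalogued Mazur obstruction (Mazur1969_inequality; audit
MazurBoundBallisticNarrow conjuncts (4)–(5): on a finite OPEN chain J = {H, Σ k·h_k} is a
coboundary, so finite-N Drude weights vanish and the printed instances live in infinite volume) does
not formally reach BLR's open-chain coefficient D_N, and every positive route (FourierGreenKubo,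
FeketeResistance, SuperadditiveJunction, LocalOhmRigidity) records "a hidden odd conserved charge"
as its informal kill criterion. This line makes that kill criterion a theorem about the CONJUNCT by
combining three published ideas with an explicit dictionary: (K) the Kundu–Dhar–Narayan open-system
Green–Kubo identity (KunduDharNarayan2009 eqs. (8)–(15): D_N = ((N−1)T²)⁻¹∫₀^∞⟨J(t)J(0)⟩_{N,T}dt, no
boundary terms), rewritten STATICALLY as D_N(N−1)T² = ⟨F,J⟩_{Gibbs} = γT Σ_b ‖∂_{p_b}F‖² with
L_{T,T}F = −J (planner-derived from the dipole identity L D_l = −2j_l + 2J_b and detailed balance L†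
= ΘLΘ; cross-checked); (V) the Sethuraman / Komorowski–Landim–Olla variational formula for
non-reversible resolvents in its one-sided Thomson form (BernardinOlla2011 §6 "Tauberian Mazur",
KomorowskiLandimOlla2012 Ch. 2, GaudilliereLandim2013), which here is a two-line Cauchy–Schwarz once
F exists; (Q) Prosen's boundary-driven Mazur bound (Prosen2011, IlievskiProsen2012: quantum XXZ with
Lindblad ends) transplanted to the classical Langevin chain: a bulk charge leaks charge and
dissipation ONLY through p_0, p_{N−1}, at rate O(1), while its current overlap is O(N). Imported
areas: non-reversible potential theory (Dirichlet/Thomson principles) and integrable-systems charge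
bookkeeping; no physical analogy beyond the exact dictionary skew part A = {H,·}, symmetric part S =
OU baths, dressing = bath-absorbability E[{H,G} | all but p_0, p_{N−1}] = const.
RANKED CRUXES. #2 DressedCharge — from an odd polynomial local charge with extensive finite-volume
overlap, build for all large N a dressed test function G_N = Q_N + boundary correctors with ∫J G_N ≥
cN and leak functional ≤ C(1+γ²) (why it might fail: a cohomological obstruction at the FREE ends —
E[{H_N,Q_N} | F_∂] may not lie in the range of w ↦ E[{H_N,w} | F_∂] over admissible correctors; then
only the undressed resolvent bound at ν_N ≍ N^{−1/2} survives and positivity/Tauberian input is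
needed; sources Prosen2011, IlievskiProsen2012, BernardinOlla2011). #3 StaticKubo — under weak-NESS
uniqueness, for every N ≥ 2 the response limit D satisfies D(N−1)T² = ∫F·J dGibbs for some C²
solution F of L_{T,T}F = −J with e^{θH} bounds on F and ∇F, θ < 1/(2T) (why it might fail:
infrastructure only — continuity of the NESS in δ at δ = 0 on e^{θH}-observables and GRADIENT growth
control of the Poisson solution ∫₀^∞P_tJ dt (Bismut/hypoelliptic gradient bounds) are unvendored;
sign/normalisation errors would be caught by the harmonic corner; sources KunduDharNarayan2009,
ReyBellet2003 Rem 4.4, HairerMajda2009, CuneoEckmannHairerReyBellet2018). #4 OddChargeExists —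
DISBELIEVED existence clause = the kill switch (why it might fail: expected false — pinning destroys
Toda/harmonic charges, DicintioEtAl2018; LocalOhmRigidity.NoLocalIntegrals (stmt-2744) is its
adversary; sources Mazur1969, Zotos2002, DicintioEtAl2018, Yamilov2006).
KILL CRITERIA. (a) A proof of NoLocalIntegrals (2744) or any classification excluding odd polynomial
local charges with extensive overlap at ALL conjunct parameters refutes OddChargeExists ⇒ close
`refuted:OddChargeExists` (bridge items kept as proved support; the necessary-condition theorem
OpenMazurBridge stands). (b) A refutation of DressedCharge by an explicit obstruction (already
computable in the harmonic calibration f = j_0, where D_N ≍ N is PROVED: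
HarmonicChainBallisticFlux.not_hasBoundedResponse) forces the pivot to the resolvent/positivity
split (card's C1) — restate, not close. (c) A refutation of StaticKubo's identity (e.g. harmonic
closed forms, HarmonicChainFlux) kills the conventions — restate with corrected normalisation.
NOT DECOMPOSED YET. The resolvent (ν > 0) variational bound and the closing alternatives (C1)
current-autocorrelation positivity / Tauberian regularity of the open-chain current spectral
measure; the 1-D Gibbs bookkeeping inside DressedCharge (free-end finite-volume vs DLR expectations,
transfer-operator clustering); the dressing linear algebra as its own item; the quasi-local
(Prosen–Ilievski) charge alarm min‖{H,Q}‖²/‖Q‖² over odd densities of range ≤ r; T- and γ-dependence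
of constants. Foreseen glued split (k = 2) once staffed: DressedCharge ⇐ BulkOverlap (static Gibbs
bounds for Q_N) → EndDressing (boundary corrector) → DressedCharge.
CHEAPEST FALSIFIER. (1) Harmonic calibration of StaticKubo/ThomsonBound conventions: at lam = β = 0
everything is Gaussian — compare D_N from HarmonicChainFlux closed forms with ∫F·J for the quadratic
F solving LF = −J (linear algebra in 2N dimensions, N = 2..6); a mismatch kills the normalisation.
(2) Dressing test in the same Gaussian setting with f = j_0: solve E[{H_N, J_N + w} | F_∂] = const
for quadratic boundary-local w (finite linear system); insolubility even with exponentially decaying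
quasi-local w flags DressedCharge. (3) NoOddChargeSmallRange itself (sympy, rational arithmetic, an
afternoon): nullspace of the conservation-law system on odd 3-site densities of degree ≤ 4 for
symbolic (ω₂, lam, β) — a nontrivial solution at positive parameters flips the route into a live
refutation of the conjunct.
TWO-LAYER PLAN. Layer 1 = the three cruxes + supports; BridgeGlue: StaticKubo → ThomsonBound →
DressedCharge → OpenMazurBridge (assume FouriersLawFor; uniqueness and the family from clause (i);
D_N → κ from clause (ii); F from StaticKubo; G from DressedCharge; ThomsonBound ⇒ D_N ≥
γc²N/(T²C(1+γ²))·N/(N−1) unbounded — contradiction); Assembly = BridgeGlue + OddChargeExists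
(assembly_of_glue, rc 0). Layer 2 later: DressedCharge ⇐ BulkOverlap → EndDressing (k = 2).
SUPPORT. ThomsonBound (Cauchy–Schwarz + Gibbs integration by parts, in-tree
integral_liouville_mul_gibbsDensity / integral_bath_mul_gibbsDensity pattern); KuboIdentity (the KDN
theorem proper in the in-tree KuboFormula/pinnedChainSemigroup language — wanted informally by
FourierGreenKubo (ii) and FeketeResistance.PositiveConductance; by the dipole identity the
integrated bond-current correlation matrix is constant in (l,k), so the single-bond form is the
right one); OpenMazurBridge (the instrument, stated alone so other routes can cite it);
NoOddChargeSmallRange (negative side of OddChargeExists in the window R = 1, deg ≤ 4; finite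
symbolic linear algebra + O(1) overlap of coboundaries); BridgeGlue.
DEGENERATE CASES CHECKED. N = 0, 1: J ≡ 0, ThomsonBound reads 0 ≤ 0; StaticKubo asks N ≥ 2; both
baths on one site for N = 1 handled by the [i=0]+[i=N−1] sums exactly as in
OscillatorChain.generator. Trivial odd conserved densities (coboundaries h − h∘shift) have O(1)
overlap, hence fail the cN clause — OddLocalCharge is not vacuous-true; Gibbs existence is never
assumed (finite-volume gibbsMeasure, proved probability for ω₂ > 0). γ enters OddLocalCharge only
vacuously (liouvilleZ, gibbsMeasure, bondCurrent ignore it).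
SOURCES. KunduDharNarayan2009; BernardinOlla2011 §6; KomorowskiLandimOlla2012 Ch. 2;
GaudilliereLandim2013; Prosen2011; IlievskiProsen2012; Mazur1969; Zotos2002; RigolShastry2008;
DicintioEtAl2018; BonettoLebowitzReyBellet2000 §5–7; ReyBellet2003 Rem 4.4; HairerMajda2009;
CuneoEckmannHairerReyBellet2018 Thm 2.13 (PROVED in tree:
CuneoEckmannHairerReyBellet2018_thm213_holds); LepriLiviPoliti2003 §8; Doyon2022 §5.1; Yamilov2006.

Novelty: Searches (2026-08-15, this planner): `lit frontier AtomisticToContinuum --since 2020` (30 rows, none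
on open-chain Mazur/KDN), `lit bridges AtomisticToContinuum --cross any`, `lit search --hybrid
"variational formula lower bound thermal conductivity conserved quantity boundary driven chain
Langevin baths Green-Kubo open system Mazur"` (textbooks only: balakrishnan2020, livi2017/2025,
gaspard2022), `lit search --source crossref "Mazur bound boundary driven Lindblad Langevin open
chain ballistic lower bound almost conserved"` (Prosen2011 doi:10.1103/physrevlett.106.217206;
Sirugue–Verbeure 1973 doi:10.1016/0031-8914(73)90242-5), `lit read arxiv:0809.4543` pp.1–3 (identity
(8)–(15), dipole step, Novikov, detailed balance), `lean search` for every constant used; plus the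
card author's searches and the novelty audit (refuter-novelty-audit-…-1-0: BernardinOlla2011 =
arXiv:1105.0493 §6 pp.16–17 'Tauberian counterpart of Mazur inequality', Prop. 7; Sethuraman 2000)
and the sibling card even-parity-dirichlet-principle (graded variant of BernardinOlla2011; its
Thomson side N3 and its Mazur remark are the same static algebra). Nearest prior art FOUND:
KunduDharNarayan2009 (open-chain GK identity, physics derivation); BernardinOlla2011 §6 +
KomorowskiLandimOlla2012 Ch.2 + GaudilliereLandim2013 (variational/Thomson formulas for
non-reversible generators; conductivity LOWER bounds from Hamiltonian charges paying the leak
⟨f,−Sf⟩ with BULK noise); Prosen2011 / IlievskiProsen2012 (boundary-d  [refs: 10.1103/physrevlett.106.217206, 10.1016/0031-8914(73, 0809.4543, 1105.0493, doi:10.1103/physrevlett.106.217206, doi:10.1016/0031-8914, arxiv:0809.4543, Prosen2011, BernardinOlla2011, KunduDharNarayan2009, KomorowskiLandimOlla2012, GaudilliereLandim2013, IlievskiProsen2012]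

Barriers (technique_class: open-chain-kubo thomson-bound dressed-bulk-charge): - technique_class: open-chain-kubo thomson-bound dressed-bulk-charge
- Literature.Barriers.AtomisticToContinuum.Mazur1969_inequality: not evaded but EXTENDED — the route
weaponises the obstruction for the open chain; the narrow audit (MazurBoundBallisticNarrow (4): J is
a coboundary on the finite open chain, finite-N Drude weight 0) is respected: the witness Q_N is NOT
conserved in the finite chain, it leaks at the free ends, and ⟨J,Q_N⟩ = −⟨Σk·h_k, {H,Q_N}⟩ ≍ N is
consistent with J = {H, Σk·h_k}; conjunct (5) (fixed size vs thermodynamic limit) is met by carrying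
the N-dependence explicitly (overlap ≍ N vs leak O(1)).
- Literature.Barriers.AtomisticToContinuum.HasBoundedResponse: used as the hinge in contrapositive
(hasBoundedResponse_of_fouriersLawFor, proved); the fixed-N ingredients (StaticKubo, ThomsonBound)
are legitimate because the conclusion D_N ≥ c′N is N-explicit through the charge, not through any
fixed-N constant.
- Literature.Barriers.AtomisticToContinuum.HarmonicChainBallisticFlux: the calibration corner (f =
j_0 is an odd range-2 conserved density of the harmonic chain with overlap ½T·C(0)(1−a²) > 0; D_N ≍
N proved there) — a regression test for StaticKubo's normalisation and for the dressing ansatz;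
formally outside the cruxes' range (β > 0).
- Literature.Barriers.AtomisticToContinuum.BeckerMenegaki2022_gapClosing: evaded — no rate or gap is
used; the sub-dimensionality of the dissipation it records (S acts on two momenta) is exactly WHY
the leak ⟨Q_N,(−S)Q_N

History (route lifecycle, newest last):
- 2026-08-15T13:45:21Z · CLOSED retired — not-a-thesis: assembly does not conclude the sub-problem Statement (operator:999:1257524)

sub-problem: FouriersLaw · status: closed(retired) · opened planner-plancard-AtomisticToContinuum-Fourier-16e0648b-0 2026-08-15T11:26:23Z · rev 0 · ledger route-AtomisticToContinuum-OpenChainMazur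
GENERATED by the gate from the ledger (D-0016/17). Provers cite these decls: `theorem foo : Summit.AtomisticToContinuum.FouriersLaw.Theses.OpenChainMazur.<Decl> := …` in Summits/AtomisticToContinuum/FouriersLaw/Theorems/<Name>.lean.
-/

namespace Summit.AtomisticToContinuum.FouriersLaw.Theses.OpenChainMazur

open scoped BigOperators Topology Manifold Classical MeasureTheory ProbabilityTheory Matrix InnerProductSpace ComplexConjugate ContinuousMap
open Filter Set Function TopologicalSpace MeasureTheory

attribute [summit_statement] _root_.FouriersLaw

/-- item stmt-AtomisticToContinuum-3962 · crux · rank 2 · closed · moot by None · by planner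
why it might fail: Cohomological obstruction at the FREE ends: E[{H_N,Q_N} | all but p_0,p_{N-1}] may not be in the range of w ↦ E[{H_N,w} | ·] for admissible correctors; then only the undressed resolvent bound (ν_N ~ N^{-1/2}) survives and positivity/Tauberian input is needed.
sources: Prosen2011, IlievskiProsen2012, BernardinOlla2011, KomorowskiLandimOlla2012, KunduDharNarayan2009
[crux] DRESSED CHARGE (card's (Q)+(C2)). For pinnedChain ω₂ lam β γ (all > 0), T > 0:
OddLocalCharge(ω₂,lam,β,γ,T) [inlined after the abstraction binder `∀ P, P = pinnedChain ω₂ lam β γ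
→`, used in every item to stay under the signature cap — provers `subst`/`rintro rfl` it]: ∃ R,
polynomial g on the (2R+1)-box and ψ on the (2R+3)-box with (i) g odd under p ↦ −p, (ii) local
conservation law of the INFINITE chain liouvilleZ (g∘boxRestrict R) = ψ∘boxRestrict(R+1) −
ψ∘boxRestrict(R+1)∘shift, (iii) extensive finite-volume overlap ∃ c>0 N₀ ∀ N ≥ N₀: c·N ≤ |∫ (Σ_i
j_i)·(Σ_{x<N−2R} g(sites x..x+2R)) d gibbsMeasure_{N,T}| ⟹ ∃ c > 0, C, N₀ such that for every N ≥ N₀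
there are C² functions G, wL, wR on PhaseSpace N with e^{θH}-growth bounds (values and first
partials, θ < 1/(2T)) which are DRESSED — {H_N, G} = T(∂*_{p_0} wL + ∂*_{p_{N−1}} wR) pointwise,
∂*_p w := −∂_p w + (p/T) w, i.e. the Liouville derivative of G is absorbable by the two baths — with
current overlap ∫ J_N G dGibbs_{N,T} ≥ cN and leak functional T Σ_b ∫ (γ′∂_{p_b}G + w_b)² ≤ C(1+γ′²)
for all γ′. Intended construction: G = Q_N + w (bulk charge plus boundary-layer correctors near each
end solving E[{H_N,Q_N}+{H_N,w} | all but -/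
@[route_item "route-AtomisticToContinuum-OpenChainMazur"]
def DressedCharge : Prop :=
  ∀ ω₂ lam β γ T : ℝ, 0 < ω₂ → 0 < lam → 0 < β → 0 < γ → 0 < T → ∀ P : Literature.MathematicalPhysics.KineticTheory.HeatConduction.OscillatorChain, P = Literature.MathematicalPhysics.KineticTheory.HeatConduction.pinnedChain ω₂ lam β γ → (∃ (R : ℕ) (g : (Fin (2 * R + 1) → ℝ × ℝ) → ℝ) (ψ : (Fin (2 * (R + 1) + 1) → ℝ × ℝ) → ℝ), (∃ p : MvPolynomial (Fin (2 * R + 1) ⊕ Fin (2 * R + 1)) ℝ, ∀ y : Fin (2 * R + 1) → ℝ × ℝ, g y = MvPolynomial.eval (Sum.elim (fun i => (y i).1) (fun i => (y i).2)) p) ∧ (∃ p : MvPolynomial (Fin (2 * (R + 1) + 1) ⊕ Fin (2 * (R + 1) + 1)) ℝ, ∀ y : Fin (2 * (R + 1) + 1) → ℝ × ℝ, ψ y = MvPolynomial.eval (Sum.elim (fun i => (y i).1) (fun i => (y i).2)) p) ∧ (∀ y : Fin (2 * R + 1) → ℝ × ℝ, g (fun i => ((y i).1, -(y i).2)) = -g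 y) ∧ (∀ σ : Literature.MathematicalPhysics.KineticTheory.HeatConduction.ChainConfig, P.liouvilleZ (g ∘ Literature.Barriers.AtomisticToContinuum.HeatConduction.boxRestrict R) σ = ψ (Literature.Barriers.AtomisticToContinuum.HeatConduction.boxRestrict (R + 1) σ) - ψ (Literature.Barriers.AtomisticToContinuum.HeatConduction.boxRestrict (R + 1) (Literature.Barriers.AtomisticToContinuum.HeatConduction.shift σ))) ∧ (∃ c : ℝ, 0 < c ∧ ∃ N₀ : ℕ, ∀ N : ℕ, N₀ ≤ N → c * (N : ℝ) ≤ |∫ z, (∑ i : Fin N, P.bondCurrent N i z) * (∑ x ∈ Finset.range (N - 2 * R), g (fun i => if h : x + i.val < N then (z.1 ⟨x + i.val, h⟩, z.2 ⟨x + i.val, h⟩) else (0, 0))) ∂(P.gibbsMeasure N T)|)) → ∃ c C : ℝ, 0 < c ∧ ∃ N₀ : ℕ, ∀ N : ℕ, N₀ ≤ N → ∃ G wL wR : Literature.MathematicalPhysics.KineticTheory.HeatConduction.PhaseSpace N → ℝ, ContDiff ℝ 2 G ∧ ContDiff ℝ 2 wL ∧ ContDiff ℝ 2 wR ∧ (∃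 C θ : ℝ, θ < 1 / (2 * T) ∧ ∀ (z : Literature.MathematicalPhysics.KineticTheory.HeatConduction.PhaseSpace N) (i : Fin N), |G z| + |wL z| + |wR z| + |Literature.MathematicalPhysics.KineticTheory.HeatConduction.partialP i G z| + |Literature.MathematicalPhysics.KineticTheory.HeatConduction.partialQ i G z| + |Literature.MathematicalPhysics.KineticTheory.HeatConduction.partialP i wL z| + |Literature.MathematicalPhysics.KineticTheory.HeatConduction.partialQ i wL z| + |Literature.MathematicalPhysics.KineticTheory.HeatConduction.partialP i wR z| + |Literature.MathematicalPhysics.KineticTheory.HeatConduction.partialQ i wR z| ≤ C * Real.exp (θ * P.hamiltonian N z)) ∧ (∀ z : Literature.MathematicalPhysics.KineticTheory.HeatConduction.PhaseSpace N, Literature.MathematicalPhysics.KineticTheory.HeatConduction.poisson (P.hamiltonian N) G z = T * ∑ i : Fin N, ((if i.val = 0 then -Literature.MathematicalPhysics.KineticTheory.HeatConduction.partialP i wL z + z.2 i / T * wL z else 0) + (if i.val = N - 1 then -Literature.MathematicalPhysics.KineticTheory.HeatConduction.partialP i wR z + z.2 i / T * wR z else 0))) ∧ c * (N : ℝ) ≤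 ∫ z, (∑ i : Fin N, P.bondCurrent N i z) * G z ∂(P.gibbsMeasure N T) ∧ ∀ γ' : ℝ, T * ∑ i : Fin N, ((if i.val = 0 then ∫ z, (γ' * Literature.MathematicalPhysics.KineticTheory.HeatConduction.partialP i G z + wL z) ^ 2 ∂(P.gibbsMeasure N T) else 0) + (if i.val = N - 1 then ∫ z, (γ' * Literature.MathematicalPhysics.KineticTheory.HeatConduction.partialP i G z + wR z) ^ 2 ∂(P.gibbsMeasure N T) else 0)) ≤ C * (1 + γ' ^ 2)

/-- item stmt-AtomisticToContinuum-3963 · crux · rank 3 · closed · moot by None · by planner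
why it might fail: Infrastructure only: continuity of the NESS at δ=0 on e^{θH}-observables and GRADIENT e^{θH}-bounds (θ<1/(2T)) for the Poisson solution ∫P_tJ dt (Bismut/hypoelliptic gradient estimates) are unvendored; a normalisation slip would show in the harmonic corner.
sources: KunduDharNarayan2009, ReyBellet2003, HairerMajda2009, CuneoEckmannHairerReyBellet2018, BonettoLebowitzReyBellet2000
[crux] STATIC KUNDU–DHAR–NARAYAN IDENTITY (card's (K), Poisson-equation form; theorem-grade, fixed
N). For pinnedChain ω₂ lam β γ (all > 0), assuming weak-NESS uniqueness (the NessUnique hypothesis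
shape of stmt-0741), for every steady-state family μ, T > 0, N ≥ 2 and every D that IS the response
limit lim_{δ→0,δ≠0} totalCurrent(μ N (T+δ/2) (T−δ/2))/δ: there is F ∈ C²(PhaseSpace N) with |F|,
|∂F| ≤ C e^{θH}, θ < 1/(2T), solving generator N T T F = −J pointwise (J = Σ_i bondCurrent i), and
D·(N−1)T² = ∫ F·J d gibbsMeasure_{N,T} (= γT Σ_b ‖∂_{p_b}F‖²_{L²(Gibbs)} ≥ 0). Proof sketch
(planner-derived, cross-checked): F := ∫₀^∞ P_t J dt (CEHR (2.5), proved in tree for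
pinnedChainSemigroup); ⟨J⟩_δ = δ∫BF dμ_δ with B = (γ/2)(∂²_{p_0} − ∂²_{p_{N−1}}) from weak
stationarity of μ_δ applied to F; continuity μ_δ → Gibbs on e^{θH}-observables ⇒ D = ∫BF dGibbs =
−T⁻²⟨F,J_b⟩, J_b = −(γ/2)(p_0²−T) + (γ/2)(p_{N−1}²−T); dipole identity L D_l = −2j_l + 2J_b and L† =
ΘLΘ give ⟨F,J⟩ = −(N−1)⟨J_b,F⟩ (KunduDharNarayan2009 (8)–(15) without Novikov). By-products: D_N ≥ 0
(half of FeketeResistance.PositiveConductance), the equilibrium Kubo form of FourierGreenKubo (ii).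
[difficulty: L] -/
@[route_item "route-AtomisticToContinuum-OpenChainMazur"]
def StaticKubo : Prop :=
  ∀ ω₂ lam β γ : ℝ, 0 < ω₂ → 0 < lam → 0 < β → 0 < γ → ∀ P : Literature.MathematicalPhysics.KineticTheory.HeatConduction.OscillatorChain, P = Literature.MathematicalPhysics.KineticTheory.HeatConduction.pinnedChain ω₂ lam β γ → (∀ (N : ℕ) (T_L T_R : ℝ), 0 < T_L → 0 < T_R → ∀ μ ν : MeasureTheory.Measure (Literature.MathematicalPhysics.KineticTheory.HeatConduction.PhaseSpace N), P.IsSteadyState N T_L T_R μ → P.IsSteadyState N T_L T_R ν → μ = ν) → ∀ μ : (N : ℕ) → ℝ → ℝ → MeasureTheory.Measure (Literature.MathematicalPhysics.KineticTheory.HeatConduction.PhaseSpace N), (∀ (N : ℕ) (T_L T_R : ℝ), 0 < T_L → 0 < T_R → P.IsSteadyState N T_L T_R (μ N T_L T_R)) → ∀ T : ℝ, 0 < T → ∀ N : ℕ, 2 ≤ N → ∀ D : ℝ, Filter.Tendsto (fun δ : ℝ => P.totalCurrent (μ N (T + δ / 2) (T - δ / 2)) / δ) (nhdsWithin 0 {(0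 : ℝ)}ᶜ) (nhds D) → ∃ F : Literature.MathematicalPhysics.KineticTheory.HeatConduction.PhaseSpace N → ℝ, ContDiff ℝ 2 F ∧ (∃ C θ : ℝ, θ < 1 / (2 * T) ∧ ∀ (z : Literature.MathematicalPhysics.KineticTheory.HeatConduction.PhaseSpace N) (i : Fin N), |F z| + |Literature.MathematicalPhysics.KineticTheory.HeatConduction.partialP i F z| + |Literature.MathematicalPhysics.KineticTheory.HeatConduction.partialQ i F z| ≤ C * Real.exp (θ * P.hamiltonian N z)) ∧ (∀ z : Literature.MathematicalPhysics.KineticTheory.HeatConduction.PhaseSpace N, P.generator N T T F z = -(∑ i : Fin N, P.bondCurrent N i z)) ∧ D * (((N : ℝ) - 1) * T ^ 2) = ∫ z, F z * (∑ i : Fin N, P.bondCurrent N i z) ∂(P.gibbsMeasure N T)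

/-- item stmt-AtomisticToContinuum-3964 · crux · rank 4 · closed · moot by None · by planner
why it might fail: Expected false: no momentum-odd local conservation law is known or expected for the quartic pinned chain at any positive parameters (pinning destroys the harmonic/Toda charges); NoLocalIntegrals (stmt-2744) would refute it outright.
sources: Mazur1969, Zotos2002, DicintioEtAl2018, Yamilov2006, LepriLiviPoliti2003
[crux] EXISTENCE CLAUSE = KILL SWITCH (DISBELIEVED; filed so that refuters/provers make the Mazur
loophole decisive for the conjunct). ∃ ω₂, lam, β, γ, T > 0 with OddLocalCharge(ω₂,lam,β,γ,T)
[inlined after the abstraction binder `∀ P, P = pinnedChain ω₂ lam β γ →`, used in every item to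
stay under the signature cap — provers `subst`/`rintro rfl` it]: ∃ R, polynomial g on the (2R+1)-box
and ψ on the (2R+3)-box with (i) g odd under p ↦ −p, (ii) local conservation law of the INFINITE
chain liouvilleZ (g∘boxRestrict R) = ψ∘boxRestrict(R+1) − ψ∘boxRestrict(R+1)∘shift, (iii) extensive
finite-volume overlap ∃ c>0 N₀ ∀ N ≥ N₀: c·N ≤ |∫ (Σ_i j_i)·(Σ_{x<N−2R} g(sites x..x+2R)) d
gibbsMeasure_{N,T}|. Expected FALSE: pinning is believed to leave energy as the only local
conservation law (DicintioEtAl2018; MazurBoundBallisticNarrow (5)); its adversary is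
LocalOhmRigidity.NoLocalIntegrals (stmt-2744: every smooth local conservation law is c·e_0 +
coboundary + const ⇒ no odd polynomial charge with extensive overlap, since coboundary densities
have O(1) overlap and e_0 is even). A proof at some parameter point makes the route refute
FouriersLaw; a refutation closes the route with the bridge items -/
@[route_item "route-AtomisticToContinuum-OpenChainMazur"]
def OddChargeExists : Prop :=
  ∃ ω₂ lam β γ T : ℝ, 0 < ω₂ ∧ 0 < lam ∧ 0 < β ∧ 0 < γ ∧ 0 < T ∧ ∀ P : Literature.MathematicalPhysics.KineticTheory.HeatConduction.OscillatorChain, P = Literature.MathematicalPhysics.KineticTheory.HeatConduction.pinnedChain ω₂ lam β γ → (∃ (R : ℕ) (g : (Fin (2 * R + 1) → ℝ × ℝ) → ℝ) (ψ : (Fin (2 * (R + 1) + 1) → ℝ × ℝ) → ℝ), (∃ p : MvPolynomial (Fin (2 * R + 1) ⊕ Fin (2 * R + 1)) ℝ, ∀ y : Fin (2 * R + 1) → ℝ × ℝ, g y = MvPolynomial.eval (Sum.elim (fun i => (y i).1) (fun i => (y i).2)) p) ∧ (∃ p : MvPolynomial (Fin (2 * (R + 1) + 1) ⊕ Fin (2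 * (R + 1) + 1)) ℝ, ∀ y : Fin (2 * (R + 1) + 1) → ℝ × ℝ, ψ y = MvPolynomial.eval (Sum.elim (fun i => (y i).1) (fun i => (y i).2)) p) ∧ (∀ y : Fin (2 * R + 1) → ℝ × ℝ, g (fun i => ((y i).1, -(y i).2)) = -g y) ∧ (∀ σ : Literature.MathematicalPhysics.KineticTheory.HeatConduction.ChainConfig, P.liouvilleZ (g ∘ Literature.Barriers.AtomisticToContinuum.HeatConduction.boxRestrict R) σ = ψ (Literature.Barriers.AtomisticToContinuum.HeatConduction.boxRestrict (R + 1) σ) - ψ (Literature.Barriers.AtomisticToContinuum.HeatConduction.boxRestrict (R + 1) (Literature.Barriers.AtomisticToContinuum.HeatConduction.shift σ))) ∧ (∃ c : ℝ, 0 < c ∧ ∃ N₀ : ℕ, ∀ N : ℕ, N₀ ≤ N → c * (N : ℝ) ≤ |∫ z, (∑ i : Fin N, P.bondCurrent N i z) * (∑ x ∈ Finset.range (N - 2 * R), g (fun i => if h : x + i.val < N then (z.1 ⟨x + i.val, h⟩, z.2 ⟨x + i.val, h⟩) else (0, 0))) ∂(P.gibbsMeasure N T)|))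

/-- item stmt-AtomisticToContinuum-3965 · support · rank 9 · closed · moot by None · by planner
sources: BernardinOlla2011, KomorowskiLandimOlla2012, GaudilliereLandim2013
[support] THOMSON LOWER BOUND (card's (V), static one-sided form; routine). For pinnedChain (all >
0), T > 0, any N and C² functions F, G, wL, wR with e^{θH} bounds (θ < 1/(2T)): if generator N T T F
= −J pointwise and G is dressed, {H_N,G} = T Σ_b ∂*_{p_b} w_b, then γ(∫ J G dGibbs)² ≤ (∫ F J
dGibbs)·(T Σ_b ∫ (γ∂_{p_b}G + w_b)² dGibbs). Proof: ∫FJ = −∫F·LF = γT Σ_b ∫(∂_bF)² (Liouville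
antisymmetry + OU integration by parts in L²(Gibbs), in-tree pattern
integral_liouville_mul_gibbsDensity / integral_bath_mul_gibbsDensity extended from C_c to the e^{θH}
class by cutoffs); ∫JG = −∫(LF)G = ∫F{H,G} + γTΣ_b∫∂_bF∂_bG = TΣ_b∫∂_bF(w_b + γ∂_bG);
Cauchy–Schwarz. Sharp: G = F_odd, w_b = γ∂_{p_b}F_even gives equality. N = 0, 1 read 0 ≤ 0.
[difficulty: M] -/
@[route_item "route-AtomisticToContinuum-OpenChainMazur"]
def ThomsonBound : Prop :=
  ∀ ω₂ lam β γ T : ℝ, 0 < ω₂ → 0 < lam → 0 < β → 0 < γ → 0 < T → ∀ P : Literature.MathematicalPhysics.KineticTheory.HeatConduction.OscillatorChain, P = Literature.MathematicalPhysics.KineticTheory.HeatConduction.pinnedChain ω₂ lam β γ → ∀ (N : ℕ) (F G wL wR : Literature.MathematicalPhysics.KineticTheory.HeatConduction.PhaseSpace N → ℝ), ContDiff ℝ 2 F → ContDiff ℝ 2 G → ContDiff ℝ 2 wL → ContDiff ℝ 2 wR → (∃ C θ : ℝ, θ < 1 / (2 * T) ∧ ∀ (z : Literature.MathematicalPhysics.KineticTheory.HeatConduction.PhaseSpace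 N) (i : Fin N), |F z| + |G z| + |wL z| + |wR z| + |Literature.MathematicalPhysics.KineticTheory.HeatConduction.partialP i F z| + |Literature.MathematicalPhysics.KineticTheory.HeatConduction.partialQ i F z| + |Literature.MathematicalPhysics.KineticTheory.HeatConduction.partialP i G z| + |Literature.MathematicalPhysics.KineticTheory.HeatConduction.partialQ i G z| + |Literature.MathematicalPhysics.KineticTheory.HeatConduction.partialP i wL z| + |Literature.MathematicalPhysics.KineticTheory.HeatConduction.partialQ i wL z| + |Literature.MathematicalPhysics.KineticTheory.HeatConduction.partialP i wR z| + |Literature.MathematicalPhysics.KineticTheory.HeatConduction.partialQ i wR z| ≤ C * Real.exp (θ * P.hamiltonian N z)) → (∀ z : Literature.MathematicalPhysics.KineticTheory.HeatConduction.PhaseSpace N, P.generator N T T F z = -(∑ i : Fin N, P.bondCurrent N i z)) → (∀ z : Literature.MathematicalPhysics.KineticTheory.HeatConduction.PhaseSpace N, Literature.MathematicalPhysics.KineticTheory.HeatConduction.poisson (P.hamiltonian N) G z = T * ∑ i : Fin N, ((if i.val = 0 then -Literature.MathematicalPhysics.KineticTheory.HeatConduction.partialP i wL z + z.2 i / T *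 wL z else 0) + (if i.val = N - 1 then -Literature.MathematicalPhysics.KineticTheory.HeatConduction.partialP i wR z + z.2 i / T * wR z else 0))) → γ * (∫ z, (∑ i : Fin N, P.bondCurrent N i z) * G z ∂(P.gibbsMeasure N T)) ^ 2 ≤ (∫ z, F z * (∑ i : Fin N, P.bondCurrent N i z) ∂(P.gibbsMeasure N T)) * (T * ∑ i : Fin N, ((if i.val = 0 then ∫ z, (γ * Literature.MathematicalPhysics.KineticTheory.HeatConduction.partialP i G z + wL z) ^ 2 ∂(P.gibbsMeasure N T) else 0) + (if i.val = N - 1 then ∫ z, (γ * Literature.MathematicalPhysics.KineticTheory.HeatConduction.partialP i G z + wR z) ^ 2 ∂(P.gibbsMeasure N T) else 0)))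

/-- item stmt-AtomisticToContinuum-3966 · support · rank 9 · closed · moot by None · by planner
sources: KunduDharNarayan2009, Prosen2011, Mazur1969
[support] THE INSTRUMENT (card's conclusion, stated alone so other routes and refuters can cite it):
for pinnedChain ω₂ lam β γ (all > 0) and T > 0, OddLocalCharge(ω₂,lam,β,γ,T) [inlined after the
abstraction binder `∀ P, P = pinnedChain ω₂ lam β γ →`, used in every item to stay under the
signature cap — provers `subst`/`rintro rfl` it]: ∃ R, polynomial g on the (2R+1)-box and ψ on the
(2R+3)-box with (i) g odd under p ↦ −p, (ii) local conservation law of the INFINITE chain liouvilleZ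
(g∘boxRestrict R) = ψ∘boxRestrict(R+1) − ψ∘boxRestrict(R+1)∘shift, (iii) extensive finite-volume
overlap ∃ c>0 N₀ ∀ N ≥ N₀: c·N ≤ |∫ (Σ_i j_i)·(Σ_{x<N−2R} g(sites x..x+2R)) d gibbsMeasure_{N,T}| ⟹
¬FouriersLawFor (pinnedChain ω₂ lam β γ). Follows from StaticKubo, ThomsonBound, DressedCharge by
BridgeGlue; contrapositively FouriersLawFor ⇒ no odd polynomial local charge with extensive current
overlap (a certified NECESSARY condition of the conjunct, the open-chain reach the Mazur barrier
lacked). [deps: StaticKubo, ThomsonBound, DressedCharge, BridgeGlue] -/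
@[route_item "route-AtomisticToContinuum-OpenChainMazur"]
def OpenMazurBridge : Prop :=
  ∀ ω₂ lam β γ T : ℝ, 0 < ω₂ → 0 < lam → 0 < β → 0 < γ → 0 < T → ∀ P : Literature.MathematicalPhysics.KineticTheory.HeatConduction.OscillatorChain, P = Literature.MathematicalPhysics.KineticTheory.HeatConduction.pinnedChain ω₂ lam β γ → (∃ (R : ℕ) (g : (Fin (2 * R + 1) → ℝ × ℝ) → ℝ) (ψ : (Fin (2 * (R + 1) + 1) → ℝ × ℝ) → ℝ), (∃ p : MvPolynomial (Fin (2 * R + 1) ⊕ Fin (2 * R + 1)) ℝ, ∀ y : Fin (2 * R + 1) → ℝ × ℝ, g y = MvPolynomial.eval (Sum.elim (fun i => (y i).1) (fun i => (y i).2)) p) ∧ (∃ p : MvPolynomial (Fin (2 * (R + 1) + 1) ⊕ Fin (2 * (R + 1) + 1)) ℝ, ∀ y : Fin (2 * (R + 1) + 1) → ℝ × ℝ, ψ y = MvPolynomial.eval (Sum.elim (fun i => (y i).1) (fun i => (y i).2)) p) ∧ (∀ y : Fin (2 * R + 1) → ℝ × ℝ, g (fun i => ((y i).1, -(y i).2))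 = -g y) ∧ (∀ σ : Literature.MathematicalPhysics.KineticTheory.HeatConduction.ChainConfig, P.liouvilleZ (g ∘ Literature.Barriers.AtomisticToContinuum.HeatConduction.boxRestrict R) σ = ψ (Literature.Barriers.AtomisticToContinuum.HeatConduction.boxRestrict (R + 1) σ) - ψ (Literature.Barriers.AtomisticToContinuum.HeatConduction.boxRestrict (R + 1) (Literature.Barriers.AtomisticToContinuum.HeatConduction.shift σ))) ∧ (∃ c : ℝ, 0 < c ∧ ∃ N₀ : ℕ, ∀ N : ℕ, N₀ ≤ N → c * (N : ℝ) ≤ |∫ z, (∑ i : Fin N, P.bondCurrent N i z) * (∑ x ∈ Finset.range (N - 2 * R), g (fun i => if h : x + i.val < N then (z.1 ⟨x + i.val, h⟩, z.2 ⟨x + i.val, h⟩) else (0, 0))) ∂(P.gibbsMeasure N T)|)) → ¬ P.FouriersLawFor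

/-- item stmt-AtomisticToContinuum-3967 · support · rank 9 · closed · moot by None · by planner
sources: KunduDharNarayan2009, BonettoLebowitzReyBellet2000, ReyBellet2003, CuneoEckmannHairerReyBellet2018
[support] KDN / BLR (32) IN THE TREE'S OWN LANGUAGE (time-domain form, for reuse by FourierGreenKubo
(ii) and FeketeResistance.PositiveConductance): under weak-NESS uniqueness, for every steady-state
family μ, T > 0 and N ≥ 1, OscillatorChain.KuboFormula N T (μ N) S₀ holds with S₀ =
pinnedChainSemigroup (the constructed transition semigroup at T_L = T_R = T): for each bond i, t ↦ ∫
j_i·P_t j_i dμ_{T,T} is integrable on (0,∞) (CEHR (2.5) exponential mixing, proved in tree) and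
lim_{δ→0} μ_{T+δ/2,T−δ/2}(j_i)/δ = T⁻² ∫₀^∞ ∫ j_i P_t j_i. Consistent with KDN because the
integrated correlation matrix M_{lk} = ∫₀^∞⟨j_l(0) j_k(t)⟩dt is CONSTANT in (l,k) (dipole identity
makes it l-independent, reversibility L† = ΘLΘ makes it symmetric), so D_N = (N−1)·M/T².
[difficulty: L] -/
@[route_item "route-AtomisticToContinuum-OpenChainMazur"]
def KuboIdentity : Prop :=
  ∀ ω₂ lam β γ : ℝ, ∀ (hω : 0 < ω₂) (hl : 0 < lam) (hβ : 0 < β) (hγ : 0 < γ), (∀ (N : ℕ) (T_L T_R : ℝ), 0 < T_L → 0 < T_R → ∀ μ ν : MeasureTheory.Measure (Literature.MathematicalPhysics.KineticTheory.HeatConduction.PhaseSpace N), (Literature.MathematicalPhysics.KineticTheory.HeatConduction.pinnedChain ω₂ lam β γ).IsSteadyState N T_L T_R μ → (Literature.MathematicalPhysics.KineticTheory.HeatConduction.pinnedChain ω₂ lam β γ).IsSteadyState N T_L T_R ν → μ = ν) → ∀ μ : (N : ℕ) → ℝ → ℝ → MeasureTheory.Measure (Literature.MathematicalPhysics.KineticTheory.HeatConduction.PhaseSpace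 N), (∀ (N : ℕ) (T_L T_R : ℝ), 0 < T_L → 0 < T_R → (Literature.MathematicalPhysics.KineticTheory.HeatConduction.pinnedChain ω₂ lam β γ).IsSteadyState N T_L T_R (μ N T_L T_R)) → ∀ T : ℝ, ∀ (hT : 0 < T), ∀ N : ℕ, ∀ (hN : 0 < N), (Literature.MathematicalPhysics.KineticTheory.HeatConduction.pinnedChain ω₂ lam β γ).KuboFormula N T (μ N) (Literature.MathematicalPhysics.KineticTheory.HeatConduction.pinnedChainSemigroup hω hl.le hβ.le hγ.le hN hT.le hT.le)

/-- item stmt-AtomisticToContinuum-3968 · support · rank 9 · closed · moot by None · by planner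
sources: Yamilov2006, DicintioEtAl2018, Mazur1969
[support] NEGATIVE SIDE OF OddChargeExists IN THE FIRST WINDOW (the card's detection protocol;
decidable by symbolic linear algebra): for all ω₂, lam, β, γ, T > 0, every odd polynomial 3-site
density g of total degree ≤ 4 satisfying a local conservation law of the infinite pinned chain (flux
ψ polynomial on 5 sites) has sub-extensive finite-volume current overlap: ∀ c > 0 there are
arbitrarily large N with |∫ J_N·Q_N dGibbs_{N,T}| < cN. Expected proof: (a) nullspace of the linear
system 'liouvilleZ(g∘box₁) − (ψ∘box₂ − ψ∘box₂∘shift) = 0' in coefficient space over ℝ(ω₂, lam, β)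
consists of coboundaries h − h∘shift (+ nothing odd else) once lam, β > 0 — the harmonic solution g
= j_0 (deg 2) must be seen to disappear; mind non-generic parameter values; (b) coboundary charges
telescope, Q_N = h(left window) − h(right window), and E_N[J_N·(…)] = O(1) uniformly in N (momentum
independence kills all but O(1) bonds; uniform moment bounds of the free-end Gibbs marginals). A
counterexample at positive parameters is a live refutation of the conjunct via OpenMazurBridge.
[difficulty: M] -/
@[route_item "route-AtomisticToContinuum-OpenChainMazur"]
def NoOddChargeSmallRange : Prop :=
  ∀ ω₂ lam β γ T : ℝ, 0 < ω₂ → 0 < lam → 0 < β → 0 < γ → 0 < T → ∀ P : Literature.MathematicalPhysics.KineticTheory.HeatConduction.OscillatorChain, P = Literature.MathematicalPhysics.KineticTheory.HeatConduction.pinnedChain ω₂ lam β γ → ∀ (g : (Fin 3 → ℝ × ℝ) → ℝ) (ψ : (Fin 5 → ℝ × ℝ) → ℝ), (∃ p : MvPolynomial (Fin 3 ⊕ Fin 3) ℝ, p.totalDegree ≤ 4 ∧ ∀ y : Fin 3 → ℝ × ℝ, g y = MvPolynomial.eval (Sum.elim (fun i => (y i).1) (fun i => (y i).2)) p) → (∃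 p : MvPolynomial (Fin 5 ⊕ Fin 5) ℝ, ∀ y : Fin 5 → ℝ × ℝ, ψ y = MvPolynomial.eval (Sum.elim (fun i => (y i).1) (fun i => (y i).2)) p) → (∀ y : Fin 3 → ℝ × ℝ, g (fun i => ((y i).1, -(y i).2)) = -g y) → (∀ σ : Literature.MathematicalPhysics.KineticTheory.HeatConduction.ChainConfig, P.liouvilleZ (g ∘ Literature.Barriers.AtomisticToContinuum.HeatConduction.boxRestrict 1) σ = ψ (Literature.Barriers.AtomisticToContinuum.HeatConduction.boxRestrict 2 σ) - ψ (Literature.Barriers.AtomisticToContinuum.HeatConduction.boxRestrict 2 (Literature.Barriers.AtomisticToContinuum.HeatConduction.shift σ))) → ∀ c : ℝ, 0 < c → ∀ N₀ : ℕ, ∃ N : ℕ, N₀ ≤ N ∧ |∫ z, (∑ i : Fin N, P.bondCurrent N i z) * (∑ x ∈ Finset.range (N - 2 * 1), g (fun i => if h : x + i.val < N then (z.1 ⟨x + i.val, h⟩, z.2 ⟨x + i.val, h⟩) else (0, 0))) ∂(P.gibbsMeasure N T)| < c * (N : ℝ)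

/-- item stmt-AtomisticToContinuum-3969 · support · rank 9 · closed · moot by None · by planner
sources: BonettoLebowitzReyBellet2000
[support] GLUE (~120 Lean lines, pure bookkeeping): StaticKubo → ThomsonBound → DressedCharge →
OpenMazurBridge. Given the charge at (ω₂,lam,β,γ,T), assume h : FouriersLawFor (pinnedChain …).
Clause (i) of h gives weak-NESS uniqueness in the (μ = ν) form and, by choice, a steady-state family
μf (positive temperatures; anything else elsewhere); clause (ii) gives κ and D : ℕ → ℝ with the
response limits along μf at T and Tendsto D atTop (nhds (κ T)), hence (|D N|) bounded. DressedCharge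
gives c, C, N₀; for N ≥ max N₀ 2 take F from StaticKubo (D := D N) and G, wL, wR from DressedCharge;
ThomsonBound yields γ(cN)² ≤ γ(∫JG)² ≤ D N·(N−1)T²·LEAK(γ) ≤ D N·(N−1)T²·C(1+γ²) (LEAK ≥ 0 as a sum
of integrals of squares; if ∫FJ < 0 the inequality is already absurd), so D N ≥
γc²N²/((N−1)T²C(1+γ²)) ≥ (γc²/(T²C(1+γ²)))·N — unbounded, contradiction. Planner check: Assembly
follows from this item and OddChargeExists (theorem assembly_of_glue, rc 0 in Sketch.lean). -/
@[route_item "route-AtomisticToContinuum-OpenChainMazur"]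
def BridgeGlue : Prop :=
  StaticKubo → ThomsonBound → DressedCharge → OpenMazurBridge

/-- item stmt-AtomisticToContinuum-3970 · assembly · rank 1 · closed · moot by None · by planner
[assembly] StaticKubo → ThomsonBound → DressedCharge → OddChargeExists → ¬FouriersLaw:
OddChargeExists supplies (ω₂, lam, β, γ, T) > 0 and the charge; BridgeGlue gives ¬FouriersLawFor
(pinnedChain ω₂ lam β γ); FouriersLaw instantiated at these parameters contradicts it (3 lines given
BridgeGlue; theorem assembly_of_glue : BridgeGlue → Assembly proved rc 0 in the planner's
Sketch.lean). NEGATIVE route: the conclusion is ¬FouriersLaw, reached only if the disbelieved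
OddChargeExists is ever proved; the durable deliverable is OpenMazurBridge. -/
@[route_item "route-AtomisticToContinuum-OpenChainMazur"]
def Assembly : Prop :=
  StaticKubo → ThomsonBound → DressedCharge → OddChargeExists → ¬ Literature.MathematicalPhysics.KineticTheory.HeatConduction.FouriersLaw

end Summit.AtomisticToContinuum.FouriersLaw.Theses.OpenChainMazur
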